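import Summits.NavierStokesRegularity.FunctionalMining.NoGo.TopBotEigSplitSharpFourScalar
import Summits.NavierStokesRegularity.FunctionalMining.NoGo.TopBotEigSplitShareNecessity
import HarnessLib

/-!
# K17 — the `q = 4` sharp share is ATTAINED: `TopBotEigSplitting 4 (2/9)`, so `c*(4) = 2/9` exactly

search for candidate a priori estimates; no regularity claim.

No-go branch (door D-K6 (c), the share window of the symmetrised top–bottom density), kernel side.
K14 (`NoGo/TopBotEigSplitShareNecessity`) proved the NECESSITY `TopBotEigSplitting 4 c → c ≤ 2/9`;
K10c (`NoGo/TopBotEigSplitting`) proved the existence of SOME positive share `shareConst 4` (not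
sharp). This file proves the SUFFICIENCY at the sharp value: there IS a convex `1`-Lipschitz
non-negative `h` with

  `λ(A)⁴ + λ(−A)⁴ = 16·h(A)⁴ + (2/9)·‖A‖⁴` on every symmetric trace-free `3 × 3` tensor `A`,

hence `IsGreatest {c | TopBotEigSplitting 4 c} (2/9)` and `sSup {c | TopBotEigSplitting 4 c} = 2/9`:
the `q = 4` share window of door (c) is CLOSED IN THE KERNEL at the dictionary's `c_axi(4) = 2/9`
(three pen hands: dict closed form, census-2 Sturm certificate, census-1 (cc.151)).

## The mechanism (Lewis-free "composition route")

On a symmetric trace-free tensor write `a = λ(A) = e₀ ≥ 0`, `b = λ(−A) = −e₂ ≥ 0` (sorted eigenvalues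
`e₀ ≥ e₁ ≥ e₂`, `e₁ = −e₀ − e₂ = b − a`). Then `‖A‖² = e₀² + e₁² + e₂² = 2(a² − ab + b²)`, so

  `λ(A)⁴ + λ(−A)⁴ − (2/9)‖A‖⁴ = F(a, b) := a⁴ + b⁴ − (8/9)(a² − ab + b²)²`
  `= ((a² − b²)² + 16ab(a − b)² + 10a²b²)/9 ≥ 0`,

and the sorted order gives the SECTOR constraint `b ≤ 2a`, `a ≤ 2b`. The candidate is
`h(A) = G(λ(πA), λ(−πA))/2` with `G = F^{1/4}` and `π` the trace-free symmetric part (K10c's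
`tfProj`). Three scalar facts make `h` convex WITHOUT any spectral Hessian (no Davis–Lewis, no
Lewis–Sendov):
* (M) `F` is non-decreasing in each variable on the closed quadrant
  (`9·∂F/∂a = 4(a³ + 4b(3a² − 3ab + b²)) ≥ 0`; here as an exact difference identity);
* (C) `u ↦ F(u, 1 − u)^{1/4}` is convex on `[1/3, 2/3]`: with `N(u) = F(u, 1 − u)` one has the exact
  identity `4NN″ − 3N′² = (3u − 1)(2 − 3u)·(80/9)(u² − u + 2/3) ≥ 0` there (second-derivative
  test, Mathlib `convexOn_of_deriv2_nonneg`) — the two roots ARE the axisymmetric walls, which is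
  why `2/9` is sharp on both sides (K14);
* (H) `G` is positively `1`-homogeneous, so (C) makes `G` subadditive on the sector (a
  two-dimensional cone whose rays all cross the segment `a + b = 1`, `a ∈ [1/3, 2/3]`).
Then `λ∘π` and `λ∘(−π)` are subadditive and positively homogeneous (tree `lam_add_le`, `lam_smul`),
their values lie in the sector, and (M) + (H) give `h(A + B) ≤ h(A) + h(B)`, `h(tA) = t·h(A)`; so `h`
is convex, and `h ≤ ‖·‖` makes it `1`-Lipschitz. On symmetric trace-free `A` (`πA = A`) the identity
is `16·(G/2)⁴ = F(a, b)`.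

## Main statements (namespace `Summit.NavierStokesRegularity.FunctionalMining.TopEig`)

* `topBotEigSplitting_four_sharp : TopBotEigSplitting 4 (2 / 9)` — the headline;
* `topBotEigSplitting_four_isGreatest : IsGreatest {c | TopBotEigSplitting 4 c} (2 / 9)` and
  `sSup_topBotEigSplitting_four : sSup {c | TopBotEigSplitting 4 c} = 2 / 9` (with K14);
* `topBotEigMoment_heatCoercive_four_sharpShare : HeatCoercive (Φ₄ + Ψ₄) (4 / (9·npConst 4))` — the
  K9 mixture rate at `q = 4` with the sharp share in place of `shareConst 4` (a by-name improvement of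
  the constant only; the NODE `TopBotEigHeatCoercivePos 4` was already K10d's).

NOT claimed: nothing for `q ≠ 4` beyond the tree (general real `q`: necessity `c ≤ c_axi(q)` is the
staged K16; attainment at `c_axi(q)` for `q ∉ {2, 4}` stays a pen statement of three hands); no
statement on `heatDissipation` beyond the displayed K9 corollary; no regularity claim.

Tree results used, by name: K10a/K10c bookkeeping (`Tens3`, `IsSymTF`, `tfProj`, `flatEv`, `lam_eq_ev`,
`lam_neg_eq_ev`, `ev_sum`, `norm_sq_eq_ev`, `lam_smul`, `norm_tfProj_le`), `TopEigRayleigh`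
(`lam_add_le`, `lam_le_norm`), K9 (`TopBotEigSplitting`, `topBotEigMoment_heatCoercive_of_splitting`),
K14 (`topBotEigSplitting_four_share_le`); Mathlib `Matrix.IsHermitian.eigenvalues₀_antitone`,
`convexOn_of_deriv2_nonneg`, `HasDerivAt.rpow_const`, `Real.rpow_inv_natCast_pow`,
`Real.pow_rpow_inv_natCast`, `LipschitzWith.of_le_add`. [ours] = this programme's own elementary work.

FILEABLE FORM (400-line lint: every tree file ≤ 399 lines) — PART 2 of 2 of the staged monolith
`NoGo/TopBotEigSplitSharpFour.STAGING.lean` beb657c0d374ab98 (518 l.): this file = its sections from `## 5.` to the end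
(declarations byte-identical, same order) and imports PART 1 `NoGo/TopBotEigSplitSharpFourScalar.lean` (the earlier sections).
search for candidate a priori estimates; no regularity claim.
FILING (prove seat g26, REQUEST #32′ part 2 of 2 (nogo g43 touch 4, HOME INBOX l.4686: two-part pure cut of the certified monolith `TopBotEigSplitSharpFour.STAGING.lean` beb657c0d374ab98 for the 400-line lint; LEAD RULING (θθ) slot #32)): declarations byte-identical to the no-go seat's staged `TopBotEigSplitSharpFourMain.STAGING.lean` b9937a0fc73b858d; additions: this line and 1 one-line `[bookkeeping]` docstring on an undocumented declaration (gate lint.docstring; RULING (ω)).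
-/

noncomputable section

open Set Real

namespace Summit.NavierStokesRegularity.FunctionalMining

namespace TopEig

/-! ## 5. The spectral bookkeeping on symmetric trace-free tensors -/

namespace IsSymTF

/-- **`(λ(A), λ(−A))` lies in the sector**: `λ(−A) ≤ 2λ(A)` and `λ(A) ≤ 2λ(−A)` on symmetric
trace-free tensors (`e₀ ≥ e₁ ≥ e₂`, `e₁ = −e₀ − e₂`). [folklore; Mathlib `eigenvalues₀_antitone` + tree
`lam_eq_ev` / `lam_neg_eq_ev` / `ev_sum`] -/
theorem lam_sector {A : Tens3} (hA : IsSymTF A) : lam (-A) ≤ 2 * lam A ∧ lam A ≤ 2 * lam (-A) := by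
  have h01 : flatEv hA.symm 1 ≤ flatEv hA.symm 0 :=
    (flatMat_isHermitian hA.symm).eigenvalues₀_antitone (by simp)
  have h12 : flatEv hA.symm 2 ≤ flatEv hA.symm 1 :=
    (flatMat_isHermitian hA.symm).eigenvalues₀_antitone (by simp)
  have hs := ev_sum hA.symm
  rw [hA.tr] at hs
  rw [lam_eq_ev hA.symm, lam_neg_eq_ev hA.symm]
  constructor <;> linarith

/-- **`‖A‖² = 2(λ(A)² − λ(A)λ(−A) + λ(−A)²)`** on symmetric trace-free tensors. [folklore; tree
`norm_sq_eq_ev`] -/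
theorem norm_sq_eq_lam {A : Tens3} (hA : IsSymTF A) :
    ‖A‖ ^ 2 = 2 * (lam A ^ 2 - lam A * lam (-A) + lam (-A) ^ 2) := by
  rw [lam_eq_ev hA.symm, lam_neg_eq_ev hA.symm, norm_sq_eq_ev hA.symm]
  have hm : flatEv hA.symm 1 = -flatEv hA.symm 0 - flatEv hA.symm 2 := by
    linarith [ev_sum hA.symm, hA.tr]
  rw [hm]; ring

/-- **The defect identity** `λ(A)⁴ + λ(−A)⁴ − (2/9)‖A‖⁴ = F(λ(A), λ(−A))`. [ours] -/
theorem quartF_lam_eq {A : Tens3} (hA : IsSymTF A) :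
    quartF (lam A) (lam (-A)) = lam A ^ 4 + lam (-A) ^ 4 - 2 / 9 * ‖A‖ ^ 4 := by
  have h4 : ‖A‖ ^ 4 = (‖A‖ ^ 2) ^ 2 := by ring
  rw [h4, hA.norm_sq_eq_lam]; unfold quartF; ring

end IsSymTF

/-! ## 6. The sharp gauge `h(A) = G(λ(πA), λ(−πA))/2` -/

/-- **The sharp `q = 4` gauge** `h(A) = F(λ(πA), λ(−πA))^{1/4}/2`, `π` = trace-free symmetric part.
[ours] -/
def sharpGauge4 (A : Tens3) : ℝ := quartG (lam (tfProj A)) (lam (-tfProj A)) / 2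

/-- `h(A) ≥ 0`. [bookkeeping] -/
theorem sharpGauge4_nonneg (A : Tens3) : 0 ≤ sharpGauge4 A := by
  have hP := isSymTF_tfProj A
  unfold sharpGauge4
  exact div_nonneg (quartG_nonneg hP.lam_nonneg hP.lam_neg_nonneg) two_pos.le

/-- Subadditivity of the sharp gauge ((M) + (H) + `λ` subadditive). [ours] -/
theorem sharpGauge4_add_le (A B : Tens3) :
    sharpGauge4 (A + B) ≤ sharpGauge4 A + sharpGauge4 B := by
  have hA := isSymTF_tfProj A
  have hB := isSymTF_tfProj B
  have hAB := isSymTF_tfProj (A + B)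
  have ha : lam (tfProj (A + B)) ≤ lam (tfProj A) + lam (tfProj B) := by
    rw [tfProj_add]; exact lam_add_le _ _
  have hb : lam (-tfProj (A + B)) ≤ lam (-tfProj A) + lam (-tfProj B) := by
    rw [tfProj_add, neg_add]; exact lam_add_le _ _
  have h1 := quartG_mono hAB.lam_nonneg hAB.lam_neg_nonneg ha hb
  have h2 := quartG_add_le hA.lam_nonneg hA.lam_neg_nonneg hA.lam_sector.1 hA.lam_sector.2
    hB.lam_nonneg hB.lam_neg_nonneg hB.lam_sector.1 hB.lam_sector.2
  unfold sharpGauge4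
  linarith

/-- Positive homogeneity of the sharp gauge. [ours] -/
theorem sharpGauge4_smul {t : ℝ} (ht : 0 ≤ t) (A : Tens3) :
    sharpGauge4 (t • A) = t * sharpGauge4 A := by
  have hA := isSymTF_tfProj A
  unfold sharpGauge4
  rw [tfProj_smul, ← smul_neg, lam_smul ht, lam_smul ht, quartG_smul ht hA.lam_nonneg hA.lam_neg_nonneg]
  ring

/-- **The sharp gauge is convex** (subadditive + positively homogeneous). [ours] -/
theorem convexOn_sharpGauge4 : ConvexOn ℝ univ sharpGauge4 := by
  refine ⟨convex_univ, fun A _ B _ a b ha hb _ => ?_⟩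
  calc sharpGauge4 (a • A + b • B) ≤ sharpGauge4 (a • A) + sharpGauge4 (b • B) :=
        sharpGauge4_add_le _ _
    _ = a • sharpGauge4 A + b • sharpGauge4 B := by
        rw [sharpGauge4_smul ha, sharpGauge4_smul hb]; rfl

/-- `h(A) ≤ ‖A‖`. [ours] -/
theorem sharpGauge4_le_norm (A : Tens3) : sharpGauge4 A ≤ ‖A‖ := by
  have hA := isSymTF_tfProj A
  have h1 := quartG_le hA.lam_nonneg hA.lam_neg_nonneg
  have h2 : lam (tfProj A) ≤ ‖tfProj A‖ := lam_le_norm _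
  have h3 : lam (-tfProj A) ≤ ‖tfProj A‖ := (lam_le_norm _).trans (norm_neg _).le
  have h4 := norm_tfProj_le A
  unfold sharpGauge4
  linarith

/-- **The sharp gauge is `1`-Lipschitz.** [ours] -/
theorem lipschitzWith_sharpGauge4 : LipschitzWith 1 sharpGauge4 :=
  LipschitzWith.of_le_add fun A B => by
    have h1 := sharpGauge4_add_le B (A - B)
    rw [add_sub_cancel] at h1
    have h2 := sharpGauge4_le_norm (A - B)
    rw [dist_eq_norm]; linarith

/-- **The sharp splitting identity** on symmetric trace-free tensors:
`λ(A)⁴ + λ(−A)⁴ = 16·h(A)⁴ + (2/9)·‖A‖⁴`. [ours] -/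
theorem sharp_splitting_identity {A : Tens3} (hA : IsSymTF A) :
    lam A ^ 4 + lam (-A) ^ 4 = 16 * sharpGauge4 A ^ 4 + 2 / 9 * ‖A‖ ^ 4 := by
  have e : sharpGauge4 A ^ 4 = quartF (lam A) (lam (-A)) / 16 := by
    unfold sharpGauge4
    rw [tfProj_of_isSymTF hA, div_pow, quartG_pow_four hA.lam_nonneg hA.lam_neg_nonneg]; norm_num
  rw [e, hA.quartF_lam_eq]; ring

/-! ## 7. The headline: `TopBotEigSplitting 4 (2/9)`; the `q = 4` window is closed -/

/-- **K17 — the `q = 4` sharp share is attained**: `TopBotEigSplitting 4 (2/9)`, with `M = 16` and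
the sharp gauge `h = sharpGauge4`. [ours] -/
theorem topBotEigSplitting_four_sharp : TopBotEigSplitting 4 (2 / 9) := by
  refine ⟨16, by norm_num, sharpGauge4, convexOn_sharpGauge4, lipschitzWith_sharpGauge4,
    fun A hs ht => ⟨sharpGauge4_nonneg A, ?_⟩⟩
  have h := sharp_splitting_identity ⟨hs, ht⟩
  simp only [rpow_ofNat]
  exact h

/-- **The `q = 4` share window is closed in the kernel**: `2/9` is the GREATEST admissible share
(attained here; upper bound = K14 `topBotEigSplitting_four_share_le`). [ours] -/
theorem topBotEigSplitting_four_isGreatest : IsGreatest {c : ℝ | TopBotEigSplitting 4 c} (2 / 9) :=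
  ⟨topBotEigSplitting_four_sharp, fun _ hc => topBotEigSplitting_four_share_le hc⟩

/-- `sup {c | TopBotEigSplitting 4 c} = 2/9` (`= c_axi(4)` of the dictionary). [ours] -/
theorem sSup_topBotEigSplitting_four : sSup {c : ℝ | TopBotEigSplitting 4 c} = 2 / 9 :=
  topBotEigSplitting_four_isGreatest.csSup_eq

/-- The sharp share in closed-form words: `2/9 = c_axi(4)` satisfies the dictionary's wall equation
`(17/36 − c)(1/4 − c) = 1/144` and is its smaller root. [bookkeeping] -/
theorem two_ninths_wall_equation :
    ((17 : ℝ) / 36 - 2 / 9) * (1 / 4 - 2 / 9) = 1 / 144 ∧ (2 : ℝ) / 9 < 1 / 4 := by norm_num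

/-- **The K9 mixture rate at `q = 4` with the sharp share**: `HeatCoercive (Φ₄ + Ψ₄) (4/(9·C_NP(4)))`
(K9 `topBotEigMoment_heatCoercive_of_splitting` at `c = 2/9`; improves the constant of K10d's
`shareConst 4`-rate, not the node). [ours] -/
theorem topBotEigMoment_heatCoercive_four_sharpShare :
    HeatCoercive (d := Fin 3) (topBotEigMoment 4) (4 / (9 * npConst 4)) := by
  have h := topBotEigMoment_heatCoercive_of_splitting (by norm_num : (2 : ℝ) < 4)
    (by norm_num : (0 : ℝ) ≤ 2 / 9) topBotEigSplitting_four_sharp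
  have e : (2 : ℝ) / 9 * 4 / (2 * npConst 4) = 4 / (9 * npConst 4) := by
    have := npConst_pos (by norm_num : (2 : ℝ) < 4)
    field_simp
  rw [e] at h
  exact h

/-! ## 8. Sanity values -/

/-- `F(1, 1) = 10/9`, `F(2, 1) = 9`, `F(1, 0) = 1/9`: planar, prolate-axisymmetric and (off-sector)
uniaxial values of the defect. -/
example : quartF 1 1 = 10 / 9 ∧ quartF 2 1 = 9 ∧ quartF 1 0 = 1 / 9 := by norm_num [quartF]

/-- The wall polynomial vanishes at both walls and equals `25/27` at the planar point `u = 1/2`. -/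
example : 4 * segN (1 / 3) * segN2 (1 / 3) - 3 * segN1 (1 / 3) ^ 2 = 0 ∧
    4 * segN (2 / 3) * segN2 (2 / 3) - 3 * segN1 (2 / 3) ^ 2 = 0 ∧
    4 * segN (1 / 2) * segN2 (1 / 2) - 3 * segN1 (1 / 2) ^ 2 = 25 / 27 := by
  refine ⟨?_, ?_, ?_⟩ <;> rw [segN_wall_identity] <;> norm_num

end TopEig

end Summit.NavierStokesRegularity.FunctionalMining
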